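import Summits.HodgeConjecture.HodgeConjecture.Theses.MarkmanPartnerTransport
import Literature.AlgebraicGeometry.Surfaces.K3BettiNumbersOfHirzebruch

/-!
# Route MarkmanPartnerTransport · crux `PicardThreeK3Squares` (stmt-HodgeConjecture-19652) —
# the UNMARKED NORMAL FORM of the crux statement, in the kernel

The crux is typed with a MARKING BINDER: for every projective K3 surface `S` and every triple
`(η, p, x)` — `η : H²(S(ℂ); ℂ) ≃ ℂ^{Λ_{K3}}` identifying integral classes with `ℤ²²` and the cup
product with the K3 form, `p` an integral generator of `H⁴`, `x = η(σ)` the period of the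
`(2,0)`-line with the Hodge–Riemann and ample-vector clauses — (`MarkedK3 S η p x`), if
`3 ≤ dim_ℂ N¹H²(S)` then `HodgeConjectureFor 4 (S ⊗ S)`. The informal statement is «the Hodge
conjecture for `S × S` for every projective K3 surface `S` with `ρ(S) ≥ 3`».

This helper file (`--supports stmt-HodgeConjecture-19652`; no definition, no sorry, no named fact
taken as hypothesis in the main theorem) proves that the marking binder carries EXACTLY the Betti
number `b₂(S) = 22` and nothing else:

* `finrank_complexBetti_two_of_marking` — a marking `η` forces `b₂(S) = 22` (`|Λ_{K3}| = 22`);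
* `picardThreeK3Squares_iff_finrank_form` — **UNCONDITIONALLY**
  `PicardThreeK3Squares ↔ ∀ S, IsK3Surface S → b₂(S) = 22 → 3 ≤ dim N¹H²(S) → HC⁴(S ⊗ S)`:
  (→) a K3 surface with `b₂(S) = 22` IS marked, by the tree's per-surface marking theorem
  `IsK3Surface.exists_marking_of_finrank_complexBetti_two` (Milnor's classification + the proved
  evenness / Hodge–Riemann / Hodge-type leaves, `K3BettiNumbersOfHirzebruch`, p808122), whose
  conclusion is the body of `MarkedK3` symbol for symbol; (←) `finrank_complexBetti_two_of_marking`;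
* `picardThreeK3Squares_of_rank_form` — the informal statement implies the typed crux outright (the
  typed crux is not stronger than its informal reading);
* `picardThreeK3Squares_iff_rank_form_of_finrank_two` /
  `picardThreeK3Squares_iff_rank_form_of_marking_exists` — modulo the ONE named fact `b₂ = 22 for every
  projective K3` (`K3_finrank_complexBetti_two`, equivalently `Huybrechts_K3_marking_exists`, the
  registered stub `stub_k3Marking` of line `cm-anchor-spread`) the crux IS its informal reading
  `∀ S, IsK3Surface S → 3 ≤ dim N¹H²(S) → HC⁴(S ⊗ S)`;
* `picardThreeK3Squares_iff_oddBetti_form_of_hirzebruch` — modulo the signature theorem in dimension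
  four alone (`hirzebruch_firstChernClass_sq_eq_almostComplex_four`, i.e. Thom's `Ω₄`), the binder is
  equivalently `b₁(S) = 0` (`b₂ + 4b₁ = 22`, `IsK3Surface.finrank_complexBetti_two_eq_iff`);
* `hodgeConjectureFor_square_of_algebraicClasses_ge_seventeen` — modulo the signature theorem alone,
  the crux already yields `HC⁴(S ⊗ S)` for every projective K3 surface with `dim N¹H²(S) ≥ 17`, with NO
  marking / GAGA input (`IsK3Surface.finrank_complexBetti_two_eq_of_algebraicClasses_ge`).

Use (for the planners who re-line the crux; the registered line `cm-anchor-spread` is dead, record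
`Cruxes/PicardThreeK3Squares/Lines/cm-anchor-spread-dead.md`): a re-lined skeleton may take the crux
in the `b₂`-form and needs the global marking fact `Huybrechts_K3_marking_exists` only for surfaces
OTHER than the crux's own `S` (which is marked by hypothesis, equivalently has `b₂ = 22`).

Honesty box. Bookkeeping about the STATEMENT of the crux; nothing here proves `PicardThreeK3Squares`,
any stub of its registered skeleton, or any instance of the Hodge conjecture. Prover seat
leafhand-hodge-markmanpartnertran-5 (gen 0).

## References

* [Huybrechts2016K3] D. Huybrechts, Lectures on K3 Surfaces (CUP 2016), Ch. 1 §3.3 (3.2)–(3.3) and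
  Prop. 3.5; Ch. 6 Prop. 1.2.
* [McDuffSalamon2017] D. McDuff, D. Salamon, Introduction to Symplectic Topology, 3rd ed. (2017),
  Rem. 4.1.10 (4.1.7) (the signature theorem in dimension four, almost complex form).
-/

set_option linter.dupNamespace false

namespace Summit.HodgeConjecture.HodgeConjecture.Theorems.MarkmanPartnerTransport.UnmarkedForm

open CategoryTheory MonoidalCategory
open Literature.AlgebraicGeometry Literature.AlgebraicGeometry.Motives Literature.AlgebraicGeometry.HodgeTheory
open Literature.AlgebraicGeometry.Surfaces Literature.AlgebraicTopology.SingularHomology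
open Literature.Geometry.Symplectic

/-- **A marking forces `b₂(S) = 22`**: a `ℂ`-linear identification `H²(S(ℂ); ℂ) ≃ ℂ^{Λ_{K3}}` gives
`dim_ℂ H²(S(ℂ); ℂ) = |Λ_{K3}| = 8 + 8 + 2 + 2 + 2 = 22`. [cite: Huybrechts2016K3, Ch. 1 §3.3 (3.3) and Prop. 3.5] -/
theorem finrank_complexBetti_two_of_marking {S : SchemeOver ℂ}
    (η : complexBetti S (2 * 1) ≃ₗ[ℂ] (K3Index → ℂ)) :
    Module.finrank ℂ (complexBetti S (2 * 1)) = 22 := by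
  rw [η.finrank_eq, Module.finrank_fintype_fun_eq_card]
  rfl

/-- **The unmarked normal form of the crux, UNCONDITIONAL:** `PicardThreeK3Squares` holds iff the
Hodge conjecture holds for `S ⊗ S` for every projective K3 surface `S` with `b₂(S) = 22` and
`3 ≤ dim_ℂ N¹H²(S)`. (→): a projective K3 surface with `b₂(S) = 22` carries a marking `(η, p, x)` with
exactly the clauses of the crux's binder (`IsK3Surface.exists_marking_of_finrank_complexBetti_two`:
Milnor's classification of even indefinite unimodular lattices, the proved evenness of the
intersection form, the Hodge–Riemann orientation of index `−16`, the `(2,0)`-line); (←): a marking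
forces `b₂(S) = 22` (`finrank_complexBetti_two_of_marking`).
[cite: Huybrechts2016K3, Ch. 1 Prop. 3.5 and Ch. 6 Prop. 1.2] -/
theorem picardThreeK3Squares_iff_finrank_form :
    Theses.MarkmanPartnerTransport.PicardThreeK3Squares ↔
      ∀ S : SchemeOver ℂ, IsK3Surface S →
        Module.finrank ℂ (complexBetti S (2 * 1)) = 22 →
        3 ≤ Module.finrank ℂ (algebraicClasses S 1) →
        HodgeConjectureFor 4 (S ⊗ S) := by
  constructor
  · intro h S hS h22 h3
    obtain ⟨η, p, x, hmark⟩ := hS.exists_marking_of_finrank_complexBetti_two h22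
    exact h S hS η p x hmark h3
  · intro h S hS η p x _ h3
    exact h S hS (finrank_complexBetti_two_of_marking η) h3

/-- **The informal statement implies the typed crux outright**: if the Hodge conjecture holds for
`S ⊗ S` for every projective K3 surface `S` with `3 ≤ dim_ℂ N¹H²(S)`, then `PicardThreeK3Squares`
(drop the marking). [cite: Huybrechts2016K3, Ch. 1 Prop. 3.5] -/
theorem picardThreeK3Squares_of_rank_form
    (h : ∀ S : SchemeOver ℂ, IsK3Surface S → 3 ≤ Module.finrank ℂ (algebraicClasses S 1) →
      HodgeConjectureFor 4 (S ⊗ S)) :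
    Theses.MarkmanPartnerTransport.PicardThreeK3Squares :=
  picardThreeK3Squares_iff_finrank_form.2 fun S hS _ h3 => h S hS h3

/-- **Modulo `b₂ = 22` for every projective K3 surface** (the named fact
`K3_finrank_complexBetti_two`, Huybrechts Ch. 1 §3.3 (3.3)) **the crux IS its informal reading**:
`PicardThreeK3Squares ↔ ∀ S, IsK3Surface S → 3 ≤ dim_ℂ N¹H²(S) → HC⁴(S ⊗ S)`. CONDITIONAL on the
named fact (hypothesis `h22`). [cite: Huybrechts2016K3, Ch. 1 §3.3 (3.3) and Prop. 3.5] -/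
theorem picardThreeK3Squares_iff_rank_form_of_finrank_two (h22 : K3_finrank_complexBetti_two) :
    Theses.MarkmanPartnerTransport.PicardThreeK3Squares ↔
      ∀ S : SchemeOver ℂ, IsK3Surface S → 3 ≤ Module.finrank ℂ (algebraicClasses S 1) →
        HodgeConjectureFor 4 (S ⊗ S) :=
  ⟨fun h S hS h3 => picardThreeK3Squares_iff_finrank_form.1 h S hS (h22 S hS) h3,
    picardThreeK3Squares_of_rank_form⟩

/-- **Modulo the marking fact `Huybrechts_K3_marking_exists`** (the registered stub `stub_k3Marking`
of line `cm-anchor-spread`; equivalent to `K3_finrank_complexBetti_two` unconditionally,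
`Huybrechts_K3_marking_exists_iff_finrank_complexBetti_two`) **the crux IS its informal reading.**
CONDITIONAL on the named fact (hypothesis `hm`). [cite: Huybrechts2016K3, Ch. 1 Prop. 3.5] -/
theorem picardThreeK3Squares_iff_rank_form_of_marking_exists (hm : Huybrechts_K3_marking_exists) :
    Theses.MarkmanPartnerTransport.PicardThreeK3Squares ↔
      ∀ S : SchemeOver ℂ, IsK3Surface S → 3 ≤ Module.finrank ℂ (algebraicClasses S 1) →
        HodgeConjectureFor 4 (S ⊗ S) :=
  picardThreeK3Squares_iff_rank_form_of_finrank_two (K3_finrank_complexBetti_two_of_marking_exists hm)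

/-- **Modulo the signature theorem in dimension four alone** (`⟨c₁², [N]⟩ = 2e + 3τ` on closed almost
complex `4`-manifolds, the named fact `hirzebruch_firstChernClass_sq_eq_almostComplex_four`; for a
projective K3 surface it gives `b₂ + 4b₁ = 22`, `IsK3Surface.finrank_complexBetti_two_eq_iff`) **the
marking binder of the crux is equivalently `b₁(S) = 0`:**
`PicardThreeK3Squares ↔ ∀ S, IsK3Surface S → b₁(S) = 0 → 3 ≤ dim_ℂ N¹H²(S) → HC⁴(S ⊗ S)`.
CONDITIONAL on the named fact (hypothesis `hHW`).
[cite: Huybrechts2016K3, Ch. 1 §3.3 p. 24] [cite: McDuffSalamon2017, Rem. 4.1.10 (4.1.7)] -/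
theorem picardThreeK3Squares_iff_oddBetti_form_of_hirzebruch
    (hHW : hirzebruch_firstChernClass_sq_eq_almostComplex_four) :
    Theses.MarkmanPartnerTransport.PicardThreeK3Squares ↔
      ∀ S : SchemeOver ℂ, IsK3Surface S →
        Module.finrank ℂ (complexBetti S 1) = 0 →
        3 ≤ Module.finrank ℂ (algebraicClasses S 1) →
        HodgeConjectureFor 4 (S ⊗ S) := by
  rw [picardThreeK3Squares_iff_finrank_form]
  refine forall_congr' fun S => forall_congr' fun hS => ?_
  rw [hS.finrank_complexBetti_two_eq_iff hHW]

/-- **Modulo the signature theorem and `b₁ = b₃ = 0`** (`Huybrechts_K3_oddBetti_vanish`, whose own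
residual is GAGA for `H¹(S, 𝒪_S)`, file `K3BettiNumbersOfGAGA`) **the crux IS its informal reading**
(through `K3_finrank_complexBetti_two_of_hirzebruch_of_oddBetti`). CONDITIONAL on both named facts.
[cite: Huybrechts2016K3, Ch. 1 §3.3 p. 24] [cite: McDuffSalamon2017, Rem. 4.1.10 (4.1.7)] -/
theorem picardThreeK3Squares_iff_rank_form_of_hirzebruch_of_oddBetti
    (hHW : hirzebruch_firstChernClass_sq_eq_almostComplex_four)
    (hodd : Huybrechts_K3_oddBetti_vanish) :
    Theses.MarkmanPartnerTransport.PicardThreeK3Squares ↔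
      ∀ S : SchemeOver ℂ, IsK3Surface S → 3 ≤ Module.finrank ℂ (algebraicClasses S 1) →
        HodgeConjectureFor 4 (S ⊗ S) :=
  picardThreeK3Squares_iff_rank_form_of_finrank_two
    (K3_finrank_complexBetti_two_of_hirzebruch_of_oddBetti hHW hodd)

/-- **Modulo the signature theorem alone, the crux already gives `HC⁴(S ⊗ S)` for every projective
K3 surface with `dim_ℂ N¹H²(S) ≥ 17`** (e.g. Picard number `≥ 17`: Kummer surfaces, singular K3
surfaces) — with NO marking and NO GAGA input: `ρ + 2 ≤ b₂ = 22 − 4b₁` forces `b₂(S) = 22`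
(`IsK3Surface.finrank_complexBetti_two_eq_of_algebraicClasses_ge`), then the `b₂`-form of the crux.
CONDITIONAL on `hirzebruch_firstChernClass_sq_eq_almostComplex_four` and on the crux itself
(hypotheses `hHW`, `h`). [cite: Huybrechts2016K3, Ch. 1 §3.3 (3.2)–(3.3) and p. 24]
[cite: McDuffSalamon2017, Rem. 4.1.10 (4.1.7)] -/
theorem hodgeConjectureFor_square_of_algebraicClasses_ge_seventeen
    (hHW : hirzebruch_firstChernClass_sq_eq_almostComplex_four)
    (h : Theses.MarkmanPartnerTransport.PicardThreeK3Squares)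
    {S : SchemeOver ℂ} (hS : IsK3Surface S)
    (h17 : 17 ≤ Module.finrank ℂ (algebraicClasses S 1)) :
    HodgeConjectureFor 4 (S ⊗ S) :=
  picardThreeK3Squares_iff_finrank_form.1 h S hS
    (hS.finrank_complexBetti_two_eq_of_algebraicClasses_ge hHW h17).1 (le_trans (by norm_num) h17)

end Summit.HodgeConjecture.HodgeConjecture.Theorems.MarkmanPartnerTransport.UnmarkedForm
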